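import Mathlib
import Summits.NavierStokesRegularity.NavierStokesRegularity.Theorems.TaoLadderRungTwoBreakOneShiftT4W76
import HarnessLib

/-!
# The one-shift instance T4 @ ε₀ = 1/10, W = 76: the CERTIFICATE SIDE as ONE object (cell harvest/h2-tao-ladder, seat p2;
# rung1/RUNG1-P2G9-REPORT.md §37; support for K1(1) = `NoSurvivingDSSOne`, stmt-NavierStokesRegularity-20205)

MODEL lattice only (comparable circuit table T4, scale ratio `11/10`); nothing here is a statement about the
Navier–Stokes equations; no item is closed.  This module BUNDLES the nine remaining hypotheses of
`T4W76.exists_surviving_dssWave_of_cert` (module `…OneShiftT4W76`) — the window certificate `cert` and its eight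
quantitative edge-form clauses with the engine's printed numbers — into one structure `T4W76.Certificate bd`, so
that the conditional theorem reads with a single hypothesis: `Certificate bd → ∃ surviving admissible DSS wave`.
Constructing a term of `Certificate bd` (for the engine's box `bd`) IS the kernel replay of p2's validated window
run for this row (interval engine v7.5, UNAUDITED); nothing in this file constructs one.
-/

noncomputable section

-- the sub-problem namespace repeats the summit name by design (D-0017)
set_option linter.dupNamespace false

namespace Summit.NavierStokesRegularity.NavierStokesRegularity.Theorems

namespace DSSOneShift

open Set Literature.Analysis.FluidPDE Literature.Analysis.FluidPDE.TaoCascade CertificateGlueOn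
open OneShiftFrame

namespace T4W76

/-- **The certificate side of the row T4 @ ε₀ = 1/10, W = 76 as ONE object**: the window certificate of the frame
`frame bd` together with its eight quantitative clauses in the engine's edge form, constants = the printed numbers
of kit j304110 as exact rationals (rung1/RUNG1-P2G9-REPORT.md §37, clause by clause).  A term of this type is what a
kernel replay of the validated window run must produce; the engine's interval computation (unaudited) asserts that
one exists for the engine's box.  Hypothesis structure only — nothing is constructed here.
[cite: Tao2016AveragedNS, §4 Lemma 4.1 (4.8), §5.3; cell vocabulary, harvest/h2-tao-ladder rung1/RUNG1-P2G9-REPORT.md §37, rung1/INSTANCE-SHEET-T4-0.1-W76.md] -/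
structure Certificate (bd : BoxData) where
  /-- the window certificate of the frame (window-run map + Krawczyk map; module …OneShiftMapDefs) -/
  cert : OneShiftWindowCert (frame bd) (1 / 10) αT4
  /-- window amplitude hulls (engine dump column `umax`, outward-rounded: `AT4`) -/
  hAwin : ∀ w, (frame bd).Adm w → ∀ j k', (frame bd).InWindow k' → ∀ s ∈ Icc 0 (frame bd).τhi,
    |(frame bd).fullFamily cert w j k' s| ≤ AT4 k'
  /-- the hull of the renormalisation factor over the admissible set (engine STAGE2 hulls line) -/
  hgl : ∀ w, (frame bd).Adm w →
    gLo ≤ gfac (slice ((frame bd).fullFamily cert w) ((frame bd).decodeTau w)) ∧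
    gfac (slice ((frame bd).fullFamily cert w) ((frame bd).decodeTau w)) ≤ gHi
  /-- window block, edge form: `Z = 8.62e-4`, `S_b = S_π c_π = 7.89e-4`, `S_e = S_ℓ c_ℓ,out + S_θ = 1.8856e24` (engine STAGE3 lines) -/
  hWedge : ∀ u v, (frame bd).AdmLip RT4 u → (frame bd).AdmLip RT4 v → ∀ B E : ℝ,
    (∀ i, ∀ t ∈ Icc 0 (frame bd).τhi, |(frame bd).decodeTail u i (-1) t - (frame bd).decodeTail v i (-1) t| ≤ B) →
    (∀ i, ∀ t ∈ Icc 0 (frame bd).τhi,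
    |(frame bd).decodeTail u i (frame bd).W t - (frame bd).decodeTail v i (frame bd).W t| ≤ E) →
    dist ((frame bd).rawWindow cert u) ((frame bd).rawWindow cert v) ≤
    862 / 10 ^ 6 * dist u v + 789 / 10 ^ 6 * B + 18856 * 10 ^ 20 * E
  /-- renormalisation factor, edge form: `γ_x = 1.034e-9`, `γ_b = γ_π c_π = 4.37e-15`, `γ_e = 1e-60` -/
  hγedge : ∀ u v, (frame bd).AdmLip RT4 u → (frame bd).AdmLip RT4 v → ∀ B E : ℝ,
    (∀ i, ∀ t ∈ Icc 0 (frame bd).τhi, |(frame bd).decodeTail u i (-1) t - (frame bd).decodeTail v i (-1) t| ≤ B) →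
    (∀ i, ∀ t ∈ Icc 0 (frame bd).τhi,
    |(frame bd).decodeTail u i (frame bd).W t - (frame bd).decodeTail v i (frame bd).W t| ≤ E) →
    |gfac (slice ((frame bd).fullFamily cert u) ((frame bd).decodeTau u)) -
    gfac (slice ((frame bd).fullFamily cert v) ((frame bd).decodeTau v))| ≤
    1034 / 10 ^ 12 * dist u v + 437 / 10 ^ 17 * B + 1 / 10 ^ 60 * E
  /-- left-behind shell `0` at the moving flight time: `dz₀ = 6.76e-10`, `χ_b = 4.1e-5`, `χ_e = 1e-60` (dump site-0 columns) -/
  hZedge : ∀ u v, (frame bd).AdmLip RT4 u → (frame bd).AdmLip RT4 v → ∀ i, ∀ B E : ℝ,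
    (∀ i, ∀ t ∈ Icc 0 (frame bd).τhi, |(frame bd).decodeTail u i (-1) t - (frame bd).decodeTail v i (-1) t| ≤ B) →
    (∀ i, ∀ t ∈ Icc 0 (frame bd).τhi,
    |(frame bd).decodeTail u i (frame bd).W t - (frame bd).decodeTail v i (frame bd).W t| ≤ E) →
    |(frame bd).fullFamily cert u i 0 ((frame bd).decodeTau u) -
    (frame bd).fullFamily cert v i 0 ((frame bd).decodeTau v)| ≤
    676 / 10 ^ 12 * dist u v + 41 / 10 ^ 6 * B + 1 / 10 ^ 60 * E
  /-- every window shell along the flight: `vmaxT4 / χbT4 / χeT4` (dump columns vmax, chiPmax·c_π, chiLmax·c_ℓ,out) -/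
  hDedge : ∀ u v, (frame bd).AdmLip RT4 u → (frame bd).AdmLip RT4 v → ∀ j k', (frame bd).InWindow k' →
    ∀ s ∈ Icc 0 (frame bd).τhi, ∀ B E : ℝ,
    (∀ i, ∀ t ∈ Icc 0 (frame bd).τhi, |(frame bd).decodeTail u i (-1) t - (frame bd).decodeTail v i (-1) t| ≤ B) →
    (∀ i, ∀ t ∈ Icc 0 (frame bd).τhi,
    |(frame bd).decodeTail u i (frame bd).W t - (frame bd).decodeTail v i (frame bd).W t| ≤ E) →
    |(frame bd).fullFamily cert u j k' s - (frame bd).fullFamily cert v j k' s| ≤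
    vmaxT4 k' * dist u v + χbT4 k' * B + χeT4 k' * E
  /-- Krawczyk inclusion: the raw window output of every admissible point lies in the unit box -/
  hwinIn : ∀ u, (frame bd).AdmLip RT4 u →
    (∀ i k, |((frame bd).rawWindow cert u).1 i k| ≤ 1) ∧ |((frame bd).rawWindow cert u).2| ≤ 1
  /-- wake entry: `|g z_{i,0}(τ) − ĝ ŷ_{i,0}| ≤ A₁ = 2.26e-6` (engine STAGE2 wake entry line) -/
  hA1 : ∀ w, (frame bd).Adm w → ∀ i,
    |gfac (slice ((frame bd).fullFamily cert w) ((frame bd).decodeTau w)) *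
    (frame bd).fullFamily cert w i 0 ((frame bd).decodeTau w) - (frame bd).tubeC i (-1)| ≤ 226 / 10 ^ 8

variable (bd : BoxData)

/-- **One-hypothesis form of the T4 @ 1/10, W = 76 instance**: the certificate object yields a surviving admissible
DSS blow-up wave of the bi-infinite T4 lattice at `1 + ε₀ = 11/10`.  Conditional; model lattice only; does not close
stmt-20205 (single `(ε₀, α)`).
[cite: Tao2016AveragedNS, §4 Lemma 4.1 (4.8), §5.3–§6; cell vocabulary, harvest/h2-tao-ladder rung1/RUNG1-P2G9-REPORT.md §35–§37] -/
theorem exists_surviving_dssWave_of_certificate (C : Certificate bd) :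
    ∃ (T : ℝ) (Φ : Unit → ℝ → Em 4), 0 < T ∧ IsDSSWave (1 / 10) αT4 (Equiv.refl Unit) T Φ ∧
      Surviving 1 (1 / 10) T ∧ ∃ x, Φ () x ≠ 0 :=
  exists_surviving_dssWave_of_cert bd C.cert C.hAwin C.hgl C.hWedge C.hγedge C.hZedge C.hDedge C.hwinIn C.hA1

/-- The same, packaged with the class membership `αT4 ∈ InTableClass 15` (counter-instance SHAPE for K1(1) at one
scale ratio, conditional on the certificate object). [cite: Tao2016AveragedNS, §4 (4.2)–(4.3), §6.1; cell vocabulary (`InTableClass`), module …CircuitTableT4] -/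
theorem exists_inTableClass_surviving_dssWave_of_certificate (C : Certificate bd) :
    ∃ α : Fin 4 → Fin 4 → Fin 4 → ℤ × ℤ × ℤ → ℝ, InTableClass 15 α ∧
      ∃ (T : ℝ) (Φ : Unit → ℝ → Em 4), 0 < T ∧ IsDSSWave (1 / 10) α (Equiv.refl Unit) T Φ ∧
        Surviving 1 (1 / 10) T ∧ ∃ x, Φ () x ≠ 0 :=
  exists_inTableClass_surviving_dssWave_of_cert bd C.cert C.hAwin C.hgl C.hWedge C.hγedge C.hZedge C.hDedge
    C.hwinIn C.hA1

end T4W76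

end DSSOneShift

end Summit.NavierStokesRegularity.NavierStokesRegularity.Theorems
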